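import Literature.Analysis.FluidPDE.ElgindiTransportOperator
import HarnessLib

/-!
# The profile equation around `F_*`: the `g`-equation of Elgindi's §9 in the
Elgindi–Ghoul–Masmoudi normalisation ([Elgindi2021] §9, pp. 30–31; [ElgindiGhoulMasmoudi2021] §2.3)

Topic `Literature/Analysis/FluidPDE`. Support file (definitions with bodies and proved theorems, no
named facts) on the proof path of the named fact
`Literature.Analysis.FluidPDE.Elgindi.ElgindiGhoulMasmoudi2021_stabilityCore`
(`ElgindiStabilityDecomposition.lean`). T. M. Elgindi, Ann. of Math. 194 (2021) =
arXiv:1904.04795, §9 "Self-similar variables and modulation" (pp. 30–31): the computation of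
`U, V, 𝓡` of `sin(2θ)L₁₂(F)`, the decomposition `F = F_* + g`, the choice `λ = −2μ/(1+μ)` and the
equation `𝓛_Γ^T(g) = −μ̄ (Γ/c)(2z²/(1+z)³) + 𝓝₀ + 𝓝 + 𝓝_*`; Elgindi–Ghoul–Masmoudi,
arXiv:1910.14071, §2.3 (p. 7): the profile system `F + (1+δ)z∂_zF + U(Φ_F)∂_θF + αV(Φ_F)z∂_zF = 𝓡(Φ_F)F`.

Everything here is pointwise algebra on the open strip, in the tree's (= EGM's) normalisation
`F_* = (Γ/c)·4αz/(1+z)²`, `L₁₂(F_*) = 4α/(1+z)` (twice Elgindi's time-dilated profile):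
* `phiLead α Λ = sin(2θ)Λ(z)/(4α)`, the leading part of a stream function with `Λ = L₁₂(F)`; for
  `Λ' = −M/z` (`M = (F,K)_θ`): `U(Φ^L) = −(3/4α) sin2θ·Λ + ¼ sin2θ·M`,
  `V(Φ^L) = (cos2θ − sin²θ)Λ/(2α)`, `𝓡(Φ^L) = Λ/(2α) − ½ sin²θ·M` (Elgindi p. 30, three displays);
* `transportForm α Ψ F = U(Ψ)∂_θF + αV(Ψ)D_zF − 𝓡(Ψ)F`, so that the profile equation with parameters
  `(μ, λ)` reads `(1+μ)F + (1+μ)(1+λ)D_zF + transportForm α Φ F = 0`;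
* **the `g`-equation** (`gEquation_identity`): for `F = F_* + g`, `(1+μ)(1+λ) = 1 − μ`, any `Φ`,
  `(1+μ)F + (1+μ)(1+λ)D_zF + T(Φ,F) = 𝓛_Γ^T g + μ̄·(Γ/c)(2z²/(1+z)³) + μ(g − D_zg) + 𝓝₀' + T(Φ^r, F)`
  with `Φ^r = Φ − Φ^L`, `μ̄ = 4αμ − L₁₂((3/(1+z))D_θg)(0)` and the explicit nonlocal remainder
  `nZero` (`𝓝₀'`, Elgindi's `−𝓝₀` together with the `(F,K)_θ`-terms he files under `𝓝`);
* the exact cancellation of §9.1.1 (`leadSelfInteraction_eq`):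
  `−(3/4α) sin2θ L₁₂(F_*)∂_θF_* + ½(cos2θ − sin²θ)L₁₂(F_*)D_zF_* = −16α²z²(1 − 3sin²θ)Γ/(c(1+z)⁴)`,
  and `F_* − D_zF_* = 4α·(Γ/c)(2z²/(1+z)³)` (the `μ`-term is a multiple of the projector profile).
-/

noncomputable section

open Set Real Function
open _root_.Topology

namespace Literature.Analysis.FluidPDE

namespace Elgindi

/-! ### The leading part of a stream function and its transport coefficients -/

/-- **`Φ^L = sin(2θ)Λ(z)/(4α)`**, the leading part of the stream function of a datum with `L₁₂ = Λ`. [cite: Elgindi2021, §9 (p. 30 of arXiv:1904.04795): "Φ − (1/4α) sin(2θ)L₁₂(F) satisfies much better estimates"] -/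
def phiLead (α : ℝ) (Λ : ℝ → ℝ) (z θ : ℝ) : ℝ := Real.sin (2 * θ) * Λ z / (4 * α)

/-- **The transport–stretching form `T(Ψ, F) = U(Ψ)∂_θF + αV(Ψ)D_zF − 𝓡(Ψ)F`.** [cite: ElgindiGhoulMasmoudi2021, §2.3 (p. 7 of arXiv:1910.14071): the profile system] -/
def transportForm (α : ℝ) (Ψ F : ℝ → ℝ → ℝ) (z θ : ℝ) : ℝ :=
  opU α Ψ z θ * dθ F z θ + α * opV Ψ z θ * Dz F z θ - opR α Ψ z θ * F z θ

/-- The profile equation of `IsProfile` is `F + (1+δ)D_zF + T(Φ,F) = 0`. [folklore] -/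
theorem profileEq_iff_transportForm (α δ : ℝ) (F Φ : ℝ → ℝ → ℝ) (z θ : ℝ) :
    F z θ + (1 + δ) * Dz F z θ + opU α Φ z θ * dθ F z θ + α * opV Φ z θ * Dz F z θ = opR α Φ z θ * F z θ ↔
      F z θ + (1 + δ) * Dz F z θ + transportForm α Φ F z θ = 0 := by
  unfold transportForm
  constructor <;> intro h <;> linarith

section lead

variable {α : ℝ} (hα : α ≠ 0) {Λ : ℝ → ℝ} {Mz : ℝ} {z θ : ℝ} (hz : 0 < z) (hθ : θ ∈ Ioo 0 (π / 2))
  (hΛ : HasDerivAt Λ (-Mz / z) z)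

/-- `∂_θΦ^L = 2cos(2θ)Λ/(4α)`. [folklore] -/
theorem dθ_phiLead (α : ℝ) (Λ : ℝ → ℝ) (z θ : ℝ) : dθ (phiLead α Λ) z θ = 2 * Real.cos (2 * θ) * Λ z / (4 * α) := by
  unfold dθ phiLead
  have h1 : HasDerivAt (fun x : ℝ => 2 * x) 2 θ := by simpa using (hasDerivAt_id θ).const_mul 2
  have h : HasDerivAt (fun θ' => Real.sin (2 * θ') * Λ z / (4 * α)) (Real.cos (2 * θ) * 2 * Λ z / (4 * α)) θ :=
    (h1.sin.mul_const (Λ z)).div_const (4 * α)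
  rw [h.deriv]; ring

include hΛ hz in
/-- `D_zΦ^L = −sin(2θ)M/(4α)` when `zΛ' = −M`. [folklore] -/
theorem Dz_phiLead (θ : ℝ) : Dz (phiLead α Λ) z θ = -(Real.sin (2 * θ) * Mz) / (4 * α) := by
  rw [Dz_apply]
  unfold phiLead
  have h : HasDerivAt (fun z' => Real.sin (2 * θ) * Λ z' / (4 * α)) (Real.sin (2 * θ) * (-Mz / z) / (4 * α)) z :=
    (hΛ.const_mul (Real.sin (2 * θ))).div_const (4 * α)
  rw [h.deriv]
  field_simp

include hΛ hz in
/-- **`U(Φ^L) = −(3/4α) sin2θ·Λ + ¼ sin2θ·M`.** [cite: Elgindi2021, §9 (p. 30 of arXiv:1904.04795): "U(sin(2θ)L₁₂(F)) = −3 sin(2θ)L₁₂(F) + α sin(2θ)(F,K)"] -/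
theorem opU_phiLead (hα : α ≠ 0) (θ : ℝ) :
    opU α (phiLead α Λ) z θ = -(3 / (4 * α)) * Real.sin (2 * θ) * Λ z + Real.sin (2 * θ) * Mz / 4 := by
  unfold opU
  rw [Dz_phiLead hz hΛ]
  unfold phiLead
  field_simp
  ring

include hθ in
/-- **`V(Φ^L) = (cos2θ − sin²θ)Λ/(2α)`.** [cite: Elgindi2021, §9 (p. 30 of arXiv:1904.04795): "V(sin(2θ)L₁₂(F)) = 2(cos(2θ) − sin²(θ))L₁₂(F)"] -/
theorem opV_phiLead (α : ℝ) (Λ : ℝ → ℝ) (z : ℝ) :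
    opV (phiLead α Λ) z θ = (Real.cos (2 * θ) - Real.sin θ ^ 2) * Λ z / (2 * α) := by
  have hc : Real.cos θ ≠ 0 := (Real.cos_pos_of_mem_Ioo ⟨by linarith [hθ.1, Real.pi_pos], hθ.2⟩).ne'
  unfold opV
  rw [dθ_phiLead]
  unfold phiLead
  rw [Real.tan_eq_sin_div_cos, Real.sin_two_mul]
  field_simp
  ring

include hΛ hz hθ in
/-- **`𝓡(Φ^L) = Λ/(2α) − ½ sin²θ·M`.** [cite: Elgindi2021, §9 (p. 30 of arXiv:1904.04795): "𝓡(sin(2θ)L₁₂(F)) = 2L₁₂(F) − 2α sin²(θ)(F,K)"] -/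
theorem opR_phiLead (hα : α ≠ 0) :
    opR α (phiLead α Λ) z θ = Λ z / (2 * α) - Real.sin θ ^ 2 * Mz / 2 := by
  have hc : Real.cos θ ≠ 0 := (Real.cos_pos_of_mem_Ioo ⟨by linarith [hθ.1, Real.pi_pos], hθ.2⟩).ne'
  unfold opR
  rw [Dz_phiLead hz hΛ, dθ_phiLead]
  unfold phiLead
  rw [Real.sin_two_mul, Real.cos_two_mul]
  field_simp
  rw [Real.sin_sq]
  ring

include hΛ hz hθ in
/-- **`T(Φ^L, F)` in closed form**: `U(Φ^L)∂_θF + αV(Φ^L)D_zF − 𝓡(Φ^L)F =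
(−(3/4α)sΛ + ¼sM)∂_θF + ½(cos2θ − sin²θ)Λ·D_zF − (Λ/(2α) − ½sin²θM)F`. [cite: Elgindi2021, §9 (p. 30 of arXiv:1904.04795)] -/
theorem transportForm_phiLead (hα : α ≠ 0) (F : ℝ → ℝ → ℝ) :
    transportForm α (phiLead α Λ) F z θ =
      (-(3 / (4 * α)) * Real.sin (2 * θ) * Λ z + Real.sin (2 * θ) * Mz / 4) * dθ F z θ +
        (Real.cos (2 * θ) - Real.sin θ ^ 2) * Λ z / 2 * Dz F z θ - (Λ z / (2 * α) - Real.sin θ ^ 2 * Mz / 2) * F z θ := by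
  unfold transportForm
  rw [opU_phiLead hz hΛ hα, opV_phiLead hθ, opR_phiLead hz hθ hΛ hα]
  field_simp

end lead

/-! ### Linearity of `T` in the stream function -/

/-- **`T(Ψ₁ + Ψ₂, F) = T(Ψ₁, F) + T(Ψ₂, F)`** at a point where the slices of `Ψ₁, Ψ₂` are differentiable. [folklore] -/
theorem transportForm_add_left (α : ℝ) {Ψ₁ Ψ₂ : ℝ → ℝ → ℝ} (F : ℝ → ℝ → ℝ) {z θ : ℝ}
    (h1z : DifferentiableAt ℝ (fun z' => Ψ₁ z' θ) z) (h2z : DifferentiableAt ℝ (fun z' => Ψ₂ z' θ) z)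
    (h1θ : DifferentiableAt ℝ (fun θ' => Ψ₁ z θ') θ) (h2θ : DifferentiableAt ℝ (fun θ' => Ψ₂ z θ') θ) :
    transportForm α (fun z' θ' => Ψ₁ z' θ' + Ψ₂ z' θ') F z θ = transportForm α Ψ₁ F z θ + transportForm α Ψ₂ F z θ := by
  have hDz : Dz (fun z' θ' => Ψ₁ z' θ' + Ψ₂ z' θ') z θ = Dz Ψ₁ z θ + Dz Ψ₂ z θ := by
    simp only [Dz_apply]
    rw [show (fun z' => Ψ₁ z' θ + Ψ₂ z' θ) = (fun z' => Ψ₁ z' θ) + fun z' => Ψ₂ z' θ from rfl, deriv_add h1z h2z]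
    ring
  have hdθ : dθ (fun z' θ' => Ψ₁ z' θ' + Ψ₂ z' θ') z θ = dθ Ψ₁ z θ + dθ Ψ₂ z θ := by
    simp only [dθ]
    rw [show (fun θ' => Ψ₁ z θ' + Ψ₂ z θ') = (fun θ' => Ψ₁ z θ') + fun θ' => Ψ₂ z θ' from rfl, deriv_add h1θ h2θ]
  unfold transportForm opU opV opR
  rw [hDz, hdθ]
  ring

/-! ### `F_*`: radial derivative, the `μ`-term and the self-interaction cancellation -/

/-- `D_zF_* = (Γ/c)·4αz(1−z)/(1+z)³` for `z > 0`. [folklore] -/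
theorem Dz_fundamentalProfile (α : ℝ) {z : ℝ} (hz : 0 < z) (θ : ℝ) :
    Dz (fundamentalProfile α) z θ = z * (angularWeight α θ / profileConst α * (4 * α * (1 - z) / (1 + z) ^ 3)) := by
  rw [Dz_apply, (hasDerivAt_fundamentalProfile α θ (by positivity : (1:ℝ) + z ≠ 0)).deriv]

/-- `∂_θF_*` inside the quarter: `sin(2θ)∂_θF_* = (2α/3)(1 − 3sin²θ)F_*`. [folklore] -/
theorem sin_two_mul_mul_dθ_fundamentalProfile (α z : ℝ) {θ : ℝ} (hθ : θ ∈ Ioo 0 (π / 2)) :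
    Real.sin (2 * θ) * dθ (fundamentalProfile α) z θ = 2 * α / 3 * (1 - 3 * Real.sin θ ^ 2) * fundamentalProfile α z θ := by
  have e : (fun θ' => fundamentalProfile α z θ') = fun θ' => (4 * α * z / (1 + z) ^ 2 / profileConst α) * angularWeight α θ' := by
    funext θ'; simp only [fundamentalProfile]; ring
  unfold dθ
  rw [e, deriv_const_mul_field]
  have h := sin_two_mul_mul_deriv_angularWeight α hθ
  simp only [fundamentalProfile]
  calc Real.sin (2 * θ) * (4 * α * z / (1 + z) ^ 2 / profileConst α * deriv (angularWeight α) θ)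
      = 4 * α * z / (1 + z) ^ 2 / profileConst α * (Real.sin (2 * θ) * deriv (angularWeight α) θ) := by ring
    _ = 4 * α * z / (1 + z) ^ 2 / profileConst α * (2 * α / 3 * (1 - 3 * Real.sin θ ^ 2) * angularWeight α θ) := by rw [h]
    _ = 2 * α / 3 * (1 - 3 * Real.sin θ ^ 2) * (angularWeight α θ / profileConst α * (4 * α * z / (1 + z) ^ 2)) := by ring

/-- The `θ`-slice of `F_*` is differentiable inside the quarter. [folklore] -/
theorem differentiableAt_fundamentalProfile_θ (α z : ℝ) {θ : ℝ} (hθ : θ ∈ Ioo 0 (π / 2)) :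
    DifferentiableAt ℝ (fun θ' => fundamentalProfile α z θ') θ := by
  have e : (fun θ' => fundamentalProfile α z θ') = fun θ' => (4 * α * z / (1 + z) ^ 2 / profileConst α) * angularWeight α θ' := by
    funext θ'; simp only [fundamentalProfile]; ring
  rw [e]
  exact ((hasDerivAt_angularWeight α hθ).differentiableAt).const_mul _

/-- The `z`-slice of `F_*` is differentiable for `z > 0`. [folklore] -/
theorem differentiableAt_fundamentalProfile_z (α θ : ℝ) {z : ℝ} (hz : 0 < z) :
    DifferentiableAt ℝ (fun z' => fundamentalProfile α z' θ) z :=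
  (hasDerivAt_fundamentalProfile α θ (by positivity : (1:ℝ) + z ≠ 0)).differentiableAt

/-- **The `μ`-term is a multiple of the projector profile**: `F_* − D_zF_* = 4α·(Γ/c)(2z²/(1+z)³)`. [cite: Elgindi2021, §9 (p. 31 of arXiv:1904.04795): "This will cancel all terms which vanish only linearly at z = 0"] -/
theorem fundamentalProfile_sub_Dz (α : ℝ) {z : ℝ} (hz : 0 < z) (θ : ℝ) :
    fundamentalProfile α z θ - Dz (fundamentalProfile α) z θ = 4 * α * projKernel α z θ := by
  rw [Dz_fundamentalProfile α hz]
  have hz1 : (1:ℝ) + z ≠ 0 := by positivity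
  simp only [fundamentalProfile, projKernel]
  field_simp
  ring

/-- **The self-interaction cancellation of §9.1.1** (exact form of `Γ`): on the strip,
`−(3/4α) sin2θ·L₁₂(F_*)·∂_θF_* + ½(cos2θ − sin²θ)L₁₂(F_*)D_zF_* = −16α²z²(1 − 3sin²θ)Γ/(c(1+z)⁴)`
(`L₁₂(F_*) = 4α/(1+z)`; the two terms vanishing linearly at `z = 0` cancel). [cite: Elgindi2021, §9.1.1 (p. 31 of arXiv:1904.04795)] -/
theorem leadSelfInteraction_eq (α : ℝ) {z θ : ℝ} (hz : 0 < z) (hθ : θ ∈ Ioo 0 (π / 2)) :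
    -(3 / (4 * α)) * Real.sin (2 * θ) * (4 * α / (1 + z)) * dθ (fundamentalProfile α) z θ +
        1 / 2 * (Real.cos (2 * θ) - Real.sin θ ^ 2) * (4 * α / (1 + z)) * Dz (fundamentalProfile α) z θ =
      -(16 * α ^ 2 * z ^ 2 * (1 - 3 * Real.sin θ ^ 2) * angularWeight α θ / (profileConst α * (1 + z) ^ 4)) := by
  have hz1 : (1:ℝ) + z ≠ 0 := by positivity
  have h1 := sin_two_mul_mul_dθ_fundamentalProfile α z hθ
  have hc2 : Real.cos (2 * θ) - Real.sin θ ^ 2 = 1 - 3 * Real.sin θ ^ 2 := by rw [Real.cos_two_mul, Real.cos_sq']; ring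
  rw [hc2, Dz_fundamentalProfile α hz]
  by_cases hα : α = 0
  · subst hα; simp
  have e1 : -(3 / (4 * α)) * Real.sin (2 * θ) * (4 * α / (1 + z)) * dθ (fundamentalProfile α) z θ =
      -(3 / (1 + z)) * (Real.sin (2 * θ) * dθ (fundamentalProfile α) z θ) := by field_simp
  rw [e1, h1]
  simp only [fundamentalProfile]
  field_simp
  ring

/-! ### The `g`-equation -/

/-- **The explicit nonlocal remainder `𝓝₀'`** of the `g`-equation (everything produced by the leading
part `Φ^L` of the stream function except the terms absorbed in `𝓛_Γ^T`, the `μ`-terms and the model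
identity): with `L_* = 4α/(1+z)`, `M_* = 4αz/(1+z)²`, `Lg = L₁₂(g)`, `Mg = (g,K)_θ`, `s = sin 2θ`,
`c₂ = cos2θ − sin²θ`,
`𝓝₀' = −(Lg/2α)g − (3/4α)sL_*∂_θF_* + ½c₂L_*D_zF_* − (3/4α)sLg(∂_θF_* + ∂_θg) + ¼s(M_*+Mg)(∂_θF_* + ∂_θg)
 + ½c₂(L_*D_zg + Lg(D_zF_* + D_zg)) + ½sin²θ(M_*+Mg)(F_* + g)`. [cite: Elgindi2021, §9 (p. 31 of arXiv:1904.04795): the terms 𝓝₀ and the (F,K)_θ-terms of 𝓝] -/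
def nZero (α : ℝ) (g : ℝ → ℝ → ℝ) (Lg Mg : ℝ → ℝ) (z θ : ℝ) : ℝ :=
  -(Lg z / (2 * α)) * g z θ
    - 3 / (4 * α) * Real.sin (2 * θ) * (4 * α / (1 + z)) * dθ (fundamentalProfile α) z θ
    + 1 / 2 * (Real.cos (2 * θ) - Real.sin θ ^ 2) * (4 * α / (1 + z)) * Dz (fundamentalProfile α) z θ
    - 3 / (4 * α) * Real.sin (2 * θ) * Lg z * (dθ (fundamentalProfile α) z θ + dθ g z θ)
    + Real.sin (2 * θ) * (4 * α * z / (1 + z) ^ 2 + Mg z) / 4 * (dθ (fundamentalProfile α) z θ + dθ g z θ)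
    + 1 / 2 * (Real.cos (2 * θ) - Real.sin θ ^ 2) * (4 * α / (1 + z) * Dz g z θ + Lg z * (Dz (fundamentalProfile α) z θ + Dz g z θ))
    + Real.sin θ ^ 2 * (4 * α * z / (1 + z) ^ 2 + Mg z) / 2 * (fundamentalProfile α z θ + g z θ)

/-- **The `g`-equation (Elgindi §9) in the EGM normalisation.** Let `F = F_* + g`, `Φ` any function
with differentiable slices at the point (its stream function in the application), `Λ = L_* + Lg` with
`zLg' = −Mg` at `z` and `Lg(z) = L₁₂(g)(z)`, and parameters with `(1+μ)(1+λ) = 1 − μ`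
(`λ = −2μ/(1+μ)`). Then at every point of the open strip
`(1+μ)F + (1+μ)(1+λ)D_zF + T(Φ, F) = 𝓛_Γ^T(g) + μ̄·(Γ/c)(2z²/(1+z)³) + μ(g − D_zg) + 𝓝₀' + T(Φ − Φ^L, F)`,
`μ̄ = 4αμ − L₁₂((3/(1+z))D_θg)(0)`. [cite: Elgindi2021, §9 (pp. 30–31 of arXiv:1904.04795): "𝓛_Γ^T(g) = −μ̄ (Γ(θ)/c)(2z²/(1+z)³) + 𝓝₀ + 𝓝 + 𝓝_*"] -/
theorem gEquation_identity {α : ℝ} (hα : 0 < α) {g Φ : ℝ → ℝ → ℝ} {Lg Mg : ℝ → ℝ} {μ lam : ℝ}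
    (hμ : (1 + μ) * (1 + lam) = 1 - μ) {z θ : ℝ} (hz : 0 < z) (hθ : θ ∈ Ioo 0 (π / 2))
    (hgz : DifferentiableAt ℝ (fun z' => g z' θ) z) (hgθ : DifferentiableAt ℝ (fun θ' => g z θ') θ)
    (hΦz : DifferentiableAt ℝ (fun z' => Φ z' θ) z) (hΦθ : DifferentiableAt ℝ (fun θ' => Φ z θ') θ)
    (hLg : HasDerivAt Lg (-Mg z / z) z) (hLg0 : Lg z = L12 g z) :
    (1 + μ) * (fundamentalProfile α z θ + g z θ) + (1 + μ) * (1 + lam) * Dz (fun z' θ' => fundamentalProfile α z' θ' + g z' θ') z θ +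
        transportForm α Φ (fun z' θ' => fundamentalProfile α z' θ' + g z' θ') z θ =
      opLΓT α g z θ + (4 * α * μ - L12 (fun z' θ' => 3 / (1 + z') * Dθ g z' θ') 0) * projKernel α z θ +
        μ * (g z θ - Dz g z θ) + nZero α g Lg Mg z θ +
        transportForm α (fun z' θ' => Φ z' θ' - phiLead α (fun w => 4 * α / (1 + w) + Lg w) z' θ')
          (fun z' θ' => fundamentalProfile α z' θ' + g z' θ') z θ := by
  have hα0 : α ≠ 0 := hα.ne'
  have hz1 : (1:ℝ) + z ≠ 0 := by positivity
  have hc : profileConst α ≠ 0 := (profileConst_pos hα.le).ne'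
  set Λ : ℝ → ℝ := fun w => 4 * α / (1 + w) + Lg w with hΛdef
  set F : ℝ → ℝ → ℝ := fun z' θ' => fundamentalProfile α z' θ' + g z' θ' with hFdef
  -- the derivative of `Λ = L_* + Lg`: `zΛ' = −(M_* + Mg)`
  have hLs : HasDerivAt (fun w : ℝ => 4 * α / (1 + w)) (-(4 * α * z / (1 + z) ^ 2) / z) z := by
    have h := ((hasDerivAt_id' z).const_add 1).fun_inv hz1
    have h2 := h.const_mul (4 * α)
    refine (h2.congr_of_eventuallyEq (Filter.Eventually.of_forall fun w => by simp [div_eq_mul_inv])).congr_deriv ?_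
    field_simp
  have hΛ : HasDerivAt Λ (-(4 * α * z / (1 + z) ^ 2 + Mg z) / z) z := by
    have := hLs.add hLg
    refine this.congr_deriv ?_
    field_simp
    ring
  -- slices of `Φ^L` are differentiable
  have hLz : DifferentiableAt ℝ (fun z' => phiLead α Λ z' θ) z := by
    unfold phiLead
    exact ((hΛ.differentiableAt.const_mul (Real.sin (2 * θ))).div_const (4 * α))
  have hLθ : DifferentiableAt ℝ (fun θ' => phiLead α Λ z θ') θ := by
    unfold phiLead
    have h1 : DifferentiableAt ℝ (fun θ' : ℝ => Real.sin (2 * θ')) θ := by fun_prop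
    exact (h1.mul_const (Λ z)).div_const (4 * α)
  -- split `Φ = Φ^L + Φ^r`
  have eΦ : Φ = fun z' θ' => phiLead α Λ z' θ' + (fun z'' θ'' => Φ z'' θ'' - phiLead α Λ z'' θ'') z' θ' := by
    funext z' θ'; ring
  have hrz : DifferentiableAt ℝ (fun z' => (fun z'' θ'' => Φ z'' θ'' - phiLead α Λ z'' θ'') z' θ) z := hΦz.sub hLz
  have hrθ : DifferentiableAt ℝ (fun θ' => (fun z'' θ'' => Φ z'' θ'' - phiLead α Λ z'' θ'') z θ') θ := hΦθ.sub hLθ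
  have hsplit : transportForm α Φ F z θ = transportForm α (phiLead α Λ) F z θ +
      transportForm α (fun z'' θ'' => Φ z'' θ'' - phiLead α Λ z'' θ'') F z θ := by
    conv_lhs => rw [eΦ]
    exact transportForm_add_left α F hLz hrz hLθ hrθ
  -- the derivatives of `F = F_* + g` at the point
  have hDzF : Dz F z θ = Dz (fundamentalProfile α) z θ + Dz g z θ := by
    simp only [Dz_apply, hFdef]
    rw [show (fun z' => fundamentalProfile α z' θ + g z' θ) = (fun z' => fundamentalProfile α z' θ) + fun z' => g z' θ from rfl,
      deriv_add (differentiableAt_fundamentalProfile_z α θ hz) hgz]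
    ring
  have hdθF : dθ F z θ = dθ (fundamentalProfile α) z θ + dθ g z θ := by
    simp only [dθ, hFdef]
    rw [show (fun θ' => fundamentalProfile α z θ' + g z θ') = (fun θ' => fundamentalProfile α z θ') + fun θ' => g z θ' from rfl,
      deriv_add (differentiableAt_fundamentalProfile_θ α z hθ) hgθ]
  -- the closed form of `T(Φ^L, F)`
  have hT := transportForm_phiLead hz hθ hΛ hα0 F
  -- the model identity `F_* + D_zF_* = (L_*/(2α))F_*` and the closed form of `D_zF_*`
  have hDzFs := Dz_fundamentalProfile α hz θ
  -- assemble
  rw [hμ, hsplit, hT, hDzF, hdθF]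
  have hF0 : F z θ = fundamentalProfile α z θ + g z θ := rfl
  rw [hF0]
  unfold nZero opLΓT opLΓ opL projP projKernel
  beta_reduce
  rw [← hLg0, Dθ_apply, hDzFs]
  simp only [hΛdef, fundamentalProfile, dθ]
  field_simp
  ring

/-! ### Rescaling `(F, Φ) ↦ (F, Φ)/(1+μ)`: from the `(μ, λ)`-equation to `IsProfile` with `δ = λ` -/

/-- `D_z(F/c) = (D_zF)/c` (no hypotheses). [folklore] -/
theorem Dz_fun_div_const (F : ℝ → ℝ → ℝ) (c z θ : ℝ) : Dz (fun z' θ' => F z' θ' / c) z θ = Dz F z θ / c := by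
  simp only [Dz_apply, deriv_div_const]; ring

/-- `∂_θ(F/c) = (∂_θF)/c` (no hypotheses). [folklore] -/
theorem dθ_fun_div_const (F : ℝ → ℝ → ℝ) (c z θ : ℝ) : dθ (fun z' θ' => F z' θ' / c) z θ = dθ F z θ / c := by
  simp only [dθ, deriv_div_const]

/-- `∂_z(F/c) = (∂_zF)/c` as functions. [folklore] -/
theorem dz_fun_div_const_eq (F : ℝ → ℝ → ℝ) (c : ℝ) : dz (fun z' θ' => F z' θ' / c) = fun z θ => dz F z θ / c := by
  funext z θ; simp only [dz, deriv_div_const]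

/-- `∂_θ(F/c) = (∂_θF)/c` as functions. [folklore] -/
theorem dθ_fun_div_const_eq (F : ℝ → ℝ → ℝ) (c : ℝ) : dθ (fun z' θ' => F z' θ' / c) = fun z θ => dθ F z θ / c := by
  funext z θ; simp only [dθ, deriv_div_const]

/-- `T(Φ/c, F/c) = T(Φ, F)/c²`. [folklore] -/
theorem transportForm_div_const (α : ℝ) (Φ F : ℝ → ℝ → ℝ) (c z θ : ℝ) :
    transportForm α (fun z' θ' => Φ z' θ' / c) (fun z' θ' => F z' θ' / c) z θ = transportForm α Φ F z θ / c ^ 2 := by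
  unfold transportForm opU opV opR
  rw [Dz_fun_div_const, Dz_fun_div_const, dθ_fun_div_const, dθ_fun_div_const]
  ring

/-- **Rescaling the profile equation**: for `1 + μ ≠ 0`,
`F/(1+μ) + (1+λ)D_z(F/(1+μ)) + T(Φ/(1+μ), F/(1+μ)) = [(1+μ)F + (1+μ)(1+λ)D_zF + T(Φ,F)]/(1+μ)²`. [cite: Elgindi2021, §9 (p. 30 of arXiv:1904.04795): the ansatz Ω = (1−(1+μ)t)⁻¹F(R/(1−(1+μ)t)^{1+λ}, θ)] -/
theorem profileResidual_rescale (α : ℝ) (Φ F : ℝ → ℝ → ℝ) {μ : ℝ} (hμ : 1 + μ ≠ 0) (lam z θ : ℝ) :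
    (fun z' θ' => F z' θ' / (1 + μ)) z θ + (1 + lam) * Dz (fun z' θ' => F z' θ' / (1 + μ)) z θ +
        transportForm α (fun z' θ' => Φ z' θ' / (1 + μ)) (fun z' θ' => F z' θ' / (1 + μ)) z θ =
      ((1 + μ) * F z θ + (1 + μ) * (1 + lam) * Dz F z θ + transportForm α Φ F z θ) / (1 + μ) ^ 2 := by
  rw [transportForm_div_const, Dz_fun_div_const]
  field_simp

/-- `L_α(Φ/c) = (L_αΦ)/c` pointwise (no hypotheses). [folklore] -/
theorem ellipticOp_fun_div_const (α : ℝ) (Φ : ℝ → ℝ → ℝ) (c z θ : ℝ) :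
    ellipticOp α (fun z' θ' => Φ z' θ' / c) z θ = ellipticOp α Φ z θ / c := by
  unfold ellipticOp
  rw [dz_fun_div_const_eq, dz_fun_div_const_eq, dθ_fun_div_const_eq, dθ_fun_div_const_eq]
  have e : (fun z' θ' => Real.tan θ' * (Φ z' θ' / c)) = fun z' θ' => (Real.tan θ' * Φ z' θ') / c := by
    funext z' θ'; ring
  rw [e, dθ_fun_div_const_eq]
  simp only
  ring

/-- **The stream function scales with the datum**: `IsStreamFunction α W Φ → IsStreamFunction α (W/c) (Φ/c)`. [folklore] -/
theorem IsStreamFunction.fun_div_const {α : ℝ} {W Φ : ℝ → ℝ → ℝ} (h : IsStreamFunction α W Φ) (c : ℝ) :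
    IsStreamFunction α (fun z θ => W z θ / c) (fun z θ => Φ z θ / c) where
  contDiffOn := h.contDiffOn.div_const c
  continuousOn := h.continuousOn.div_const c
  elliptic z θ hp := by rw [ellipticOp_fun_div_const, h.elliptic z θ hp]
  bc_zero z hz := by simp [h.bc_zero z hz]
  bc_pi_div_two z hz := by simp [h.bc_pi_div_two z hz]

/-- **From the `(μ, λ)`-equation to a profile.** If `F ∈ C¹(strip)` with stream function `Φ` solves
`(1+μ)F + (1+μ)(1+λ)D_zF + T(Φ, F) = 0` on the open strip and `1 + μ ≠ 0`, then
`(F/(1+μ), Φ/(1+μ))` is a self-similar profile with `δ = λ` in the sense of `IsProfile`. [cite: Elgindi2021, §9 (p. 30 of arXiv:1904.04795); ElgindiGhoulMasmoudi2021, §2.3 (p. 7 of arXiv:1910.14071)] -/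
theorem isProfile_of_muLambdaEquation {α μ lam : ℝ} {F Φ : ℝ → ℝ → ℝ} (hF : ContDiffOn ℝ 1 (uncurry F) strip)
    (hΦ : IsStreamFunction α F Φ) (hμ : 1 + μ ≠ 0)
    (heq : ∀ z θ, (z, θ) ∈ strip → (1 + μ) * F z θ + (1 + μ) * (1 + lam) * Dz F z θ + transportForm α Φ F z θ = 0) :
    IsProfile α lam (fun z θ => F z θ / (1 + μ)) (fun z θ => Φ z θ / (1 + μ)) where
  contDiffOn := hF.div_const _
  stream := hΦ.fun_div_const _
  profileEq z θ hp := by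
    have h := profileResidual_rescale α Φ F hμ lam z θ
    rw [heq z θ hp, zero_div] at h
    unfold transportForm at h
    simp only at h ⊢
    linarith

end Elgindi

end Literature.Analysis.FluidPDE
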